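import Summits.Langlands.Langlands.Theses.StickelbergerDial
import Literature.NumberTheory.Automorphic.ACCAutomorphyLiftingCrystalline
import HarnessLib

/-!
# `StickelbergerDial.FLLiftingWeightZero` BY NAME: kernel calibration against the named fact
# ACC+ 2023 Thm. 6.1.1 (weight zero) and the conditional closure
# (item stmt-Langlands-18016, support, rank 9; `--supports`, conditional-result)

The route decl `Summit.Langlands.Langlands.Theses.StickelbergerDial.FLLiftingWeightZero` is the
support obligation "Fontaine–Laffaille automorphy lifting for `GL_n` over a CM or totally real
field `F` at weight zero" — Allen–Calegari–Caraiani–Gee–Helm–Le Hung–Newton–Scholze–Taylor–Thorne,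
*Potential automorphy over CM fields*, Ann. of Math. (2) 197 (2023), **Theorem 6.1.1**
specialised to `λ = 0` — WRITTEN OUT over the facts-free vocabulary `HasSatakeParamAt` /
`AutomorphicRepData.IsUnramifiedAt` / `FramedGaloisRep.IsUnramifiedAt` / `HasFrobCharpolyAt` /
`arithFrobPolyOfSatake` (route-repair 2026-08-17, so that the route file's import cone carries no
holds-free Literature constant).  Binder for binder it is the tree's NAMED FACT
`Literature.NumberTheory.Automorphic.ACCGHLNSTT2023.automorphyLifting_crystalline_weightZero`
(file `Literature/NumberTheory/Automorphic/ACCAutomorphyLiftingCrystalline.lean`), whose two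
occurrences of the predicate `HLTT.IsCompatible` unfold (`HLTT.isCompatible_iff`, `Iff.rfl`) to the
inlined clauses of the item.

This module records that identity in the kernel (`route_iff_acc`, `Iff.rfl`: the item neither
loses nor gains strength against the vendored fact) and states the closure AGAINST THE ROUTE DECL
BY NAME conditionally on the named fact (`FLLiftingWeightZero_of_acc`, a `conditional-result`:
the item closes unconditionally only with a discharge
`ACCGHLNSTT2023.automorphyLifting_crystalline_weightZero_holds`, i.e. the whole of ACC+ §§2–6 —
Calegari–Geraghty patching in positive defect, the torsion local–global compatibility of the
cohomology of the locally symmetric spaces of `GL_n` over CM fields (Scholze, Caraiani–Scholze,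
ACC+ §§3–5), the Fontaine–Laffaille local deformation theory — none of which is in the tree).
It also records the two one-line specialisations the route's deciding theorem `closes` actually
consumes (`FLLiftingWeightZero_cm_trimmed`, the CM member applied with `Or.inr`, dropping the last
"`Π_v` unramified wherever `ρ` and `π` are" conjunct which `closes` discards), so that a future
discharge of a CM-only or conclusion-trimmed variant of the fact can be wired in without touching
the route file.

This file imports the Theses file and is NOT to be imported by a module that closes an item of
this route by name (the gate's `_holds` link would cycle).

References: P. B. Allen, F. Calegari, A. Caraiani, T. Gee, D. Helm, B. V. Le Hung, J. Newton,
P. Scholze, R. Taylor, J. A. Thorne, *Potential automorphy over CM fields*, Ann. of Math. (2) 197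
(2023), 897–1113 (arXiv:1812.09999), Thm. 6.1.1 (§6.1, p. 64 of the arXiv text), Def. 4.3.1,
Def. 6.2.28 [ACCGHLNSTT2023]; M. Harris, K.-W. Lan, R. Taylor, J. Thorne, *On the rigid cohomology
of certain Shimura varieties*, Res. Math. Sci. 3:37 (2016), Thm. A [HarrisLanTaylorThorneRMS2016].
-/


set_option linter.dupNamespace false -- project-wide option (lakefile weak.linter.dupNamespace); `Summit.Langlands.Langlands` is the mandated namespace

namespace Summit.Langlands.Langlands.Theorems.FLLiftingWeightZero

open Summit.Langlands.Langlands.Theses.StickelbergerDial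
open Literature.NumberTheory.Automorphic
open Literature.NumberTheory.GaloisRepresentations Literature.NumberTheory.PAdicHodge
open scoped NumberField
open NumberField IsDedekindDomain Field Filter

/-- The route decl `StickelbergerDial.FLLiftingWeightZero` is, definitionally, the named fact
`ACCGHLNSTT2023.automorphyLifting_crystalline_weightZero` (ACC+ 2023, Thm. 6.1.1 at weight
`λ = 0`): the item is the fact with its two `HLTT.IsCompatible` clauses unfolded
(`HLTT.isCompatible_iff` is `Iff.rfl`), every other binder verbatim.
[cite: ACCGHLNSTT2023, Thm. 6.1.1 (weight λ = 0)] -/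
theorem route_iff_acc :
    Summit.Langlands.Langlands.Theses.StickelbergerDial.FLLiftingWeightZero ↔
      ACCGHLNSTT2023.automorphyLifting_crystalline_weightZero :=
  Iff.rfl

/-- **Conditional closure of item stmt-Langlands-18016 by name.**  Granted the named fact
`ACCGHLNSTT2023.automorphyLifting_crystalline_weightZero` (ACC+ 2023, Thm. 6.1.1 at weight zero —
undischarged in the tree: Calegari–Geraghty patching with torsion local–global compatibility), the
route decl `StickelbergerDial.FLLiftingWeightZero` holds; the proof is the identity
(`route_iff_acc`).  A `conditional-result`: the item closes only when
`automorphyLifting_crystalline_weightZero_holds` lands, and then by `exact` this theorem applied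
to it. [cite: ACCGHLNSTT2023, Thm. 6.1.1 (weight λ = 0)] -/
theorem FLLiftingWeightZero_of_acc
    (hACC : ACCGHLNSTT2023.automorphyLifting_crystalline_weightZero) :
    Summit.Langlands.Langlands.Theses.StickelbergerDial.FLLiftingWeightZero :=
  route_iff_acc.mpr hACC

/-- Conversely the item discharges the named fact: a proof of `StickelbergerDial.FLLiftingWeightZero`
IS a proof of `ACCGHLNSTT2023.automorphyLifting_crystalline_weightZero` (so the item is exactly as
hard as the fact — neither a special case nor a strengthening). [folklore] -/
theorem acc_of_FLLiftingWeightZero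
    (h : Summit.Langlands.Langlands.Theses.StickelbergerDial.FLLiftingWeightZero) :
    ACCGHLNSTT2023.automorphyLifting_crystalline_weightZero :=
  route_iff_acc.mp h

/-- **What the route's deciding theorem consumes** (pure logic).  `StickelbergerDial.closes`
applies `FLLiftingWeightZero` only to a CM field (`Or.inr hcm`) and discards the last conjunct of
its conclusion ("`Π_v` is unramified wherever `ρ` and `π` are").  This is that CM,
conclusion-trimmed member, derived from the item: for `K` CM, under hypotheses (1)–(5) of ACC+
Thm. 6.1.1 at weight zero (verbatim the item's), there is a weight-zero cuspidal `Π` of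
`GL_n(𝔸_K)`, HLTT-compatible with `ρ` (`HLTT.IsCompatible Π.1 ι ρ`, definitionally the inlined
clause) and unramified above `p`. [cite: ACCGHLNSTT2023, Thm. 6.1.1 (weight λ = 0, F imaginary CM)] -/
theorem FLLiftingWeightZero_cm_trimmed
    (h : Summit.Langlands.Langlands.Theses.StickelbergerDial.FLLiftingWeightZero)
    (K : Type) [Field K] [NumberField K] (hK : IsCMField K) (n : ℕ)
    (hcpt : isCompact_glFiniteIntegralLevel n K) (p : ℕ) [Fact p.Prime] (hn2 : n ^ 2 < p)
    (h2n : 2 * n < p) (hunr : Algebra.IsUnramifiedIn (𝓞 K) (Ideal.span {(p : ℤ)}))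
    (ι : PadicAlgCl p ≃+* ℂ) (ρ : FramedGaloisRep K (PadicAlgCl p) n)
    (τ : absoluteGaloisGroup K →* GL (Fin n) (padicAlgClResidueField p))
    (π : CuspidalAutomorphicRepData n K hcpt) (r : FramedGaloisRep K (PadicAlgCl p) n)
    (h1 : ∀ᶠ v : HeightOneSpectrum (𝓞 K) in cofinite, ρ.IsUnramifiedAt v)
    (h2 : ∀ (v : HeightOneSpectrum (𝓞 K)) (hv : ((p : ℕ) : 𝓞 K) ∈ v.asIdeal),
      let D := fontainePstAdicCompletion v p hv
      D.IsCrystallineFramed (ρ.toLocal v) ∧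
        (letI := D.algebra
         ∀ τ' : v.adicCompletion K →ₐ[ℚ_[p]] PadicAlgCl p,
           ρ.labelledHodgeTateWeightsAt v D.algebra D.𝔅 τ'.toRingHom =
             (Multiset.range n).map fun i : ℕ => (i : ℤ)))
    (hres : ρ.IsResidualRepOf (RingHom.id _) τ) (habs : IsAbsIrreducible τ)
    (hdg : IsDecomposedGeneric τ)
    (habs' : IsAbsIrreducible (τ.comp (absGaloisGroupAdjoinRootsOfUnity K p).subtype))
    (hen : Subgroup.IsEnormous ((absGaloisGroupAdjoinRootsOfUnity K p).map τ))
    (hσ : ∃ σ : absoluteGaloisGroup K, σ ∉ absGaloisGroupAdjoinRootsOfUnity K p ∧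
      ∃ c : padicAlgClResidueField p,
        ((τ σ : GL (Fin n) (padicAlgClResidueField p)) :
          Matrix (Fin n) (Fin n) (padicAlgClResidueField p)) = c • (1 : Matrix _ _ _))
    (hwt : π.1.HasWeightZero) (hcomp : HLTT.IsCompatible π.1 ι r)
    (hres₀ : r.IsResidualRepOf (RingHom.id _) τ)
    (hunrπ : ∀ v : HeightOneSpectrum (𝓞 K), ((p : ℕ) : 𝓞 K) ∈ v.asIdeal → π.1.IsUnramifiedAt v) :
    ∃ Pi : CuspidalAutomorphicRepData n K hcpt,
      Pi.1.HasWeightZero ∧ HLTT.IsCompatible Pi.1 ι ρ ∧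
        ∀ v : HeightOneSpectrum (𝓞 K), ((p : ℕ) : 𝓞 K) ∈ v.asIdeal → Pi.1.IsUnramifiedAt v := by
  obtain ⟨Pi, hPiwt, hPicomp, hPiunr, -⟩ :=
    h K (Or.inr hK) n hcpt p hn2 h2n hunr ι ρ τ π r h1 h2 hres habs hdg habs' hen hσ hwt hcomp
      hres₀ hunrπ
  exact ⟨Pi, hPiwt, hPicomp, hPiunr⟩

end Summit.Langlands.Langlands.Theorems.FLLiftingWeightZero
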